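import Mathlib

/-!
# `SO(4)` from proper signed permutations and one coordinate `SO(2)` — exact Givens generation

Support file for item stmt-QuantumFields-9669 (`PlanarToEuclidean`, shared verbatim by the routes
PencilRigidity, MirrorModularBoosts and TransparentRPWall): the pure Euclidean-geometry half.
`so4_generation`: a predicate on the linear isometries of `ℝ⁴` that is closed under `trans` and `symm`,
holds on every determinant-one isometry permuting the axes up to sign (proper signed permutations), and
holds on every determinant-one isometry fixing `e₂, e₃` (the coordinate `SO(2)₀₁`), holds on EVERY
determinant-one isometry.  No trigonometry, closure or density: all group elements used are PRODUCTS OF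
TWO HYPERPLANE REFLECTIONS (determinant `(-1)·(-1) = 1`, Mathlib `Submodule.det_reflection`):
* the conjugators `Q_A = r_{e₀-e₂} ∘ r_{e₀}` (`e₂ ↦ e₀`, `e₃ ↦ e₃`) and `Q_B = r_{e₁-e₃} ∘ r_{e₀-e₂}`
  (`e₂ ↦ e₀`, `e₃ ↦ e₁`) are proper signed permutations and transport the `SO(2)₀₁`-hypothesis to the
  determinant-one stabilisers of `(e₀,e₃)` and of `(e₀,e₁)` (`stab_of_conj`);
* a Givens step in the coordinate plane `(a,b)` is `r_{eₐ} ∘ r_{w - ‖w‖e_b}`, `w` the `(a,b)`-part of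
  the vector (`givens`);
* three Givens steps send `R e₃` to `e₃`, two more (fixing `e₃`) send the image of `e₂` to `e₂`, and
  what remains fixes `e₂, e₃`.
The Schwinger-function statement is closed in `PencilRigidityPlanarToEuclidean.lean`.
Source: folklore (Givens rotations generate `SO(n)`); reflection idioms as in
`Theorems/NPointIsotropy/Negative/JunkInvariance.lean`.
-/

noncomputable section

-- Mathlib's `SimplexCategory` instance `Fintype (Fin (x.len + 1))` matches `Fintype (Fin 4)` and makes concrete
-- `Fin 4` instance paths diverge between elaborations (tree-known workaround, cf.
-- `Theorems/NPointIsotropy/Negative/HyperoctahedralPlane.lean`).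
attribute [-instance] SimplexCategory.instFintypeToTypeOrderHomFinHAddNatLenOfNat

namespace Summit.QuantumFields.YangMills.Theorems

namespace PlanarToEuclidean

open scoped InnerProductSpace
open Module Submodule

/-- `ℝ⁴` (file-local notation). -/
local notation "E4" => EuclideanSpace ℝ (Fin 4)

/-- The axis vector `eᵢ` (file-local notation). -/
local notation:max "𝐞" i:max => (EuclideanSpace.single (i : Fin 4) (1 : ℝ) : EuclideanSpace ℝ (Fin 4))

/-- The hyperplane reflection with normal `z` (file-local notation). -/
local notation:max "𝐫" z:max =>
  (Submodule.reflection (Submodule.span ℝ {(z : EuclideanSpace ℝ (Fin 4))})ᗮ :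
    EuclideanSpace ℝ (Fin 4) ≃ₗᵢ[ℝ] EuclideanSpace ℝ (Fin 4))

/-- The determinant of a linear isometry of `ℝ⁴` (file-local notation). -/
local notation:max "𝐝" R:max =>
  LinearMap.det (LinearIsometryEquiv.toLinearEquiv (R : EuclideanSpace ℝ (Fin 4) ≃ₗᵢ[ℝ] EuclideanSpace ℝ (Fin 4)) :
    EuclideanSpace ℝ (Fin 4) →ₗ[ℝ] EuclideanSpace ℝ (Fin 4))

/-! ### Coordinates, axis vectors, determinants -/

/-- Coordinates of the axis vectors. [folklore] -/
theorem e_apply (i j : Fin 4) : (𝐞 i) j = if j = i then 1 else 0 := by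
  simp [PiLp.single_apply]

/-- Orthonormality of the axis vectors. [folklore] -/
theorem inner_e_e (i j : Fin 4) : ⟪𝐞 i, 𝐞 j⟫_ℝ = if i = j then 1 else 0 := by
  simp [EuclideanSpace.inner_single_left, PiLp.single_apply]

/-- `⟪eᵢ, x⟫ = xᵢ`. [folklore] -/
theorem inner_e_left (i : Fin 4) (x : E4) : ⟪𝐞 i, x⟫_ℝ = x i := by
  simp [EuclideanSpace.inner_single_left]

/-- Axis vectors are unit vectors. [folklore] -/
theorem norm_e (i : Fin 4) : ‖𝐞 i‖ = 1 := by simp [PiLp.norm_single]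

/-- Axis vectors are non-zero. [folklore] -/
theorem e_ne_zero (i : Fin 4) : 𝐞 i ≠ 0 := fun h => by simpa using congrArg (fun v : E4 => v i) h

/-- `eᵢ - eⱼ ≠ 0` for `i ≠ j`. [folklore] -/
theorem e_sub_e_ne_zero {i j : Fin 4} (hij : i ≠ j) : 𝐞 i - 𝐞 j ≠ 0 := fun h => by
  have := congrArg (fun v : E4 => v i) h
  simp [hij] at this

/-- Determinant of a composite. [folklore] -/
theorem det_trans (A B : E4 ≃ₗᵢ[ℝ] E4) : 𝐝 (A.trans B) = 𝐝 A * 𝐝 B := by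
  rw [LinearIsometryEquiv.toLinearEquiv_trans, LinearEquiv.coe_trans, LinearMap.det_comp, mul_comm]

/-- Determinant of the inverse of a determinant-one isometry. [folklore] -/
theorem det_symm {A : E4 ≃ₗᵢ[ℝ] E4} (hA : 𝐝 A = 1) : 𝐝 A.symm = 1 := by
  rw [LinearIsometryEquiv.toLinearEquiv_symm, LinearEquiv.det_coe_symm, hA, inv_one]

/-! ### Hyperplane reflections -/

/-- A hyperplane reflection fixes the vectors orthogonal to its normal. [folklore] -/
theorem refl_fix {z x : E4} (h : ⟪z, x⟫_ℝ = 0) : (𝐫 z) x = x :=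
  Submodule.reflection_mem_subspace_eq_self ((Submodule.mem_orthogonal_singleton_iff_inner_right).2 h)

/-- A hyperplane reflection negates its normal. [folklore] -/
theorem refl_self (z : E4) : (𝐫 z) z = -z :=
  Submodule.reflection_orthogonalComplement_singleton_eq_neg z

/-- The reflection with normal `v - w` exchanges `v` and `w` when `‖v‖ = ‖w‖`. [folklore] -/
theorem refl_sub_left {v w : E4} (h : ‖v‖ = ‖w‖) : (𝐫 (v - w)) v = w :=
  Submodule.reflection_sub h

/-- The reflection with normal `v - w` exchanges `w` and `v` when `‖v‖ = ‖w‖`. [folklore] -/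
theorem refl_sub_right {v w : E4} (h : ‖v‖ = ‖w‖) : (𝐫 (v - w)) w = v := by
  have h1 : (𝐫 (v - w)) ((𝐫 (v - w)) v) = v := Submodule.reflection_reflection _ v
  rwa [refl_sub_left h] at h1

/-- A hyperplane reflection of `ℝ⁴` has determinant `-1`. [folklore] -/
theorem det_refl {z : E4} (hz : z ≠ 0) : 𝐝 (𝐫 z) = -1 := by
  rw [Submodule.det_reflection, Submodule.orthogonal_orthogonal, finrank_span_singleton hz, pow_one]

/-- A product of two hyperplane reflections has determinant `1`. [folklore] -/
theorem det_refl_trans_refl {z z' : E4} (hz : z ≠ 0) (hz' : z' ≠ 0) : 𝐝 ((𝐫 z).trans (𝐫 z')) = 1 := by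
  rw [det_trans, det_refl hz, det_refl hz']
  norm_num

/-! ### Reflections along `eₐ` and `eₐ - e_b` on the axis vectors -/

/-- `r_{eₐ} eₐ = -eₐ`. [folklore] -/
theorem refl_e_self (a : Fin 4) : (𝐫 (𝐞 a)) (𝐞 a) = -𝐞 a := refl_self _

/-- `r_{eₐ} e_c = e_c` for `c ≠ a`. [folklore] -/
theorem refl_e_ne {a c : Fin 4} (h : c ≠ a) : (𝐫 (𝐞 a)) (𝐞 c) = 𝐞 c :=
  refl_fix (by rw [inner_e_left, e_apply, if_neg h.symm])

/-- `r_{eₐ - e_b} eₐ = e_b`. [folklore] -/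
theorem refl_e_sub_e_left (a b : Fin 4) : (𝐫 (𝐞 a - 𝐞 b)) (𝐞 a) = 𝐞 b :=
  refl_sub_left (by rw [norm_e, norm_e])

/-- `r_{eₐ - e_b} e_b = eₐ`. [folklore] -/
theorem refl_e_sub_e_right (a b : Fin 4) : (𝐫 (𝐞 a - 𝐞 b)) (𝐞 b) = 𝐞 a :=
  refl_sub_right (by rw [norm_e, norm_e])

/-- `r_{eₐ - e_b} e_c = e_c` for `c ≠ a, b`. [folklore] -/
theorem refl_e_sub_e_ne {a b c : Fin 4} (hca : c ≠ a) (hcb : c ≠ b) : (𝐫 (𝐞 a - 𝐞 b)) (𝐞 c) = 𝐞 c :=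
  refl_fix (by rw [inner_sub_left, inner_e_left, inner_e_left, e_apply, e_apply, if_neg hca.symm,
    if_neg hcb.symm, sub_zero])

/-! ### The two conjugators -/

/-- `Q_A = r_{e₀-e₂} ∘ r_{e₀}`: `e₀ ↦ -e₂`, `e₁ ↦ e₁`, `e₂ ↦ e₀`, `e₃ ↦ e₃` (a proper signed permutation). [folklore] -/
theorem QA_spec :
    𝐝 ((𝐫 (𝐞 0)).trans (𝐫 (𝐞 0 - 𝐞 2))) = 1 ∧
    ((𝐫 (𝐞 0)).trans (𝐫 (𝐞 0 - 𝐞 2))) (𝐞 0) = -𝐞 2 ∧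
    ((𝐫 (𝐞 0)).trans (𝐫 (𝐞 0 - 𝐞 2))) (𝐞 1) = 𝐞 1 ∧
    ((𝐫 (𝐞 0)).trans (𝐫 (𝐞 0 - 𝐞 2))) (𝐞 2) = 𝐞 0 ∧
    ((𝐫 (𝐞 0)).trans (𝐫 (𝐞 0 - 𝐞 2))) (𝐞 3) = 𝐞 3 := by
  have h02 : (0 : Fin 4) ≠ 2 := by decide
  have h10 : (1 : Fin 4) ≠ 0 := by decide
  have h12 : (1 : Fin 4) ≠ 2 := by decide
  have h20 : (2 : Fin 4) ≠ 0 := by decide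
  have h30 : (3 : Fin 4) ≠ 0 := by decide
  have h32 : (3 : Fin 4) ≠ 2 := by decide
  refine ⟨det_refl_trans_refl (e_ne_zero 0) (e_sub_e_ne_zero h02), ?_, ?_, ?_, ?_⟩
  · rw [LinearIsometryEquiv.trans_apply, refl_e_self, map_neg, refl_e_sub_e_left]
  · rw [LinearIsometryEquiv.trans_apply, refl_e_ne h10, refl_e_sub_e_ne h10 h12]
  · rw [LinearIsometryEquiv.trans_apply, refl_e_ne h20, refl_e_sub_e_right]
  · rw [LinearIsometryEquiv.trans_apply, refl_e_ne h30, refl_e_sub_e_ne h30 h32]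

/-- `Q_B = r_{e₁-e₃} ∘ r_{e₀-e₂}`: `e₀ ↔ e₂`, `e₁ ↔ e₃` (a proper signed permutation). [folklore] -/
theorem QB_spec :
    𝐝 ((𝐫 (𝐞 0 - 𝐞 2)).trans (𝐫 (𝐞 1 - 𝐞 3))) = 1 ∧
    ((𝐫 (𝐞 0 - 𝐞 2)).trans (𝐫 (𝐞 1 - 𝐞 3))) (𝐞 0) = 𝐞 2 ∧
    ((𝐫 (𝐞 0 - 𝐞 2)).trans (𝐫 (𝐞 1 - 𝐞 3))) (𝐞 1) = 𝐞 3 ∧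
    ((𝐫 (𝐞 0 - 𝐞 2)).trans (𝐫 (𝐞 1 - 𝐞 3))) (𝐞 2) = 𝐞 0 ∧
    ((𝐫 (𝐞 0 - 𝐞 2)).trans (𝐫 (𝐞 1 - 𝐞 3))) (𝐞 3) = 𝐞 1 := by
  have h02 : (0 : Fin 4) ≠ 2 := by decide
  have h13 : (1 : Fin 4) ≠ 3 := by decide
  have h01 : (0 : Fin 4) ≠ 1 := by decide
  have h03 : (0 : Fin 4) ≠ 3 := by decide
  have h10 : (1 : Fin 4) ≠ 0 := by decide
  have h12 : (1 : Fin 4) ≠ 2 := by decide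
  have h21 : (2 : Fin 4) ≠ 1 := by decide
  have h23 : (2 : Fin 4) ≠ 3 := by decide
  have h30 : (3 : Fin 4) ≠ 0 := by decide
  have h32 : (3 : Fin 4) ≠ 2 := by decide
  refine ⟨det_refl_trans_refl (e_sub_e_ne_zero h02) (e_sub_e_ne_zero h13), ?_, ?_, ?_, ?_⟩
  · rw [LinearIsometryEquiv.trans_apply, refl_e_sub_e_left, refl_e_sub_e_ne h21 h23]
  · rw [LinearIsometryEquiv.trans_apply, refl_e_sub_e_ne h10 h12, refl_e_sub_e_left]
  · rw [LinearIsometryEquiv.trans_apply, refl_e_sub_e_right, refl_e_sub_e_ne h01 h03]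
  · rw [LinearIsometryEquiv.trans_apply, refl_e_sub_e_ne h30 h32, refl_e_sub_e_right]

/-! ### Givens steps -/

/-- The four elements of `Fin 4`. [folklore] -/
theorem four_cases (c : Fin 4) : c = 0 ∨ c = 1 ∨ c = 2 ∨ c = 3 := by
  revert c
  decide

/-- A unit vector of `ℝ⁴` with three vanishing coordinates and the fourth non-negative is that axis
vector. [folklore] -/
theorem eq_e_of_norm_one {u : E4} (hu : ‖u‖ = 1) (b : Fin 4) (h0 : ∀ c, c ≠ b → u c = 0)
    (hb : 0 ≤ u b) : u = 𝐞 b := by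
  have hsq : ‖u‖ ^ 2 = (u b) ^ 2 := by
    rw [EuclideanSpace.real_norm_sq_eq, Finset.sum_eq_single b (fun c _ hc => by rw [h0 c hc]; ring)
      (fun h => (h (Finset.mem_univ b)).elim)]
  rw [hu, one_pow] at hsq
  have hub : u b = 1 := by nlinarith [hsq, hb]
  ext c
  rw [e_apply]
  by_cases hc : c = b
  · subst hc; simp [hub]
  · rw [if_neg hc, h0 c hc]

/-- **Givens step in the coordinate plane `(a,b)`**: for every `v ∈ ℝ⁴` there is a determinant-one
isometry fixing the other two axis vectors, killing the `a`-coordinate of `v`, making its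
`b`-coordinate non-negative and leaving its remaining coordinates unchanged — the product of the
reflections with normals `w - ‖w‖ e_b` (`w` the `(a,b)`-part of `v`) and `e_a`. [folklore] -/
theorem givens (a b : Fin 4) (hab : a ≠ b) (v : E4) :
    ∃ R : E4 ≃ₗᵢ[ℝ] E4, 𝐝 R = 1 ∧ (∀ c, c ≠ a → c ≠ b → R (𝐞 c) = 𝐞 c) ∧ (R v) a = 0 ∧ 0 ≤ (R v) b ∧
      ∀ c, c ≠ a → c ≠ b → (R v) c = v c := by
  -- the `(a,b)`-part `w` of `v`, its target `w'`, and the rest `u`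
  set w : E4 := EuclideanSpace.single a (v a) + EuclideanSpace.single b (v b) with hw
  set m : ℝ := ‖w‖ with hm
  set w' : E4 := EuclideanSpace.single b m with hw'
  set u : E4 := v - w with hu
  have hm0 : 0 ≤ m := norm_nonneg w
  have hwa : w a = v a := by simp [hw, hab]
  have hwb : w b = v b := by simp [hw, hab.symm]
  have hwc : ∀ c, c ≠ a → c ≠ b → w c = 0 := fun c hca hcb => by simp [hw, hca, hcb]
  have hua : u a = 0 := by rw [hu, PiLp.sub_apply, hwa, sub_self]
  have hub : u b = 0 := by rw [hu, PiLp.sub_apply, hwb, sub_self]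
  have hw'a : w' a = 0 := by simp [hw', hab]
  have hw'b : w' b = m := by simp [hw']
  have hw'c : ∀ c, c ≠ a → c ≠ b → w' c = 0 := fun c _ hcb => by simp [hw', hcb]
  have hvwu : v = w + u := by rw [hu]; abel
  have hnorm : ‖w‖ = ‖w'‖ := by
    rw [hw', PiLp.norm_single, Real.norm_of_nonneg hm0]
  by_cases hww : w = w'
  · -- nothing to do: use the identity `r_{eₐ} ∘ r_{eₐ}`
    have hid : ∀ x : E4, ((𝐫 (𝐞 a)).trans (𝐫 (𝐞 a))) x = x := fun x => by
      rw [LinearIsometryEquiv.trans_apply, Submodule.reflection_reflection]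
    refine ⟨(𝐫 (𝐞 a)).trans (𝐫 (𝐞 a)), det_refl_trans_refl (e_ne_zero a) (e_ne_zero a),
      fun c _ _ => hid _, ?_, ?_, fun c _ _ => by rw [hid]⟩
    · rw [hid, ← hwa, hww, hw'a]
    · rw [hid, ← hwb, hww, hw'b]
      exact hm0
  · have hz : w - w' ≠ 0 := sub_ne_zero.2 hww
    refine ⟨(𝐫 (w - w')).trans (𝐫 (𝐞 a)), det_refl_trans_refl hz (e_ne_zero a), ?_, ?_⟩
    · intro c hca hcb
      have h1 : (𝐫 (w - w')) (𝐞 c) = 𝐞 c :=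
        refl_fix (by rw [inner_sub_left, real_inner_comm, inner_e_left, real_inner_comm, inner_e_left,
          hwc c hca hcb, hw'c c hca hcb, sub_zero])
      rw [LinearIsometryEquiv.trans_apply, h1, refl_e_ne hca]
    · have hRv : ((𝐫 (w - w')).trans (𝐫 (𝐞 a))) v = w' + u := by
        rw [LinearIsometryEquiv.trans_apply, hvwu, map_add, refl_sub_left hnorm,
          refl_fix (z := w - w') (x := u) ?_, refl_fix ?_]
        · rw [inner_e_left, PiLp.add_apply, hw'a, hua, add_zero]
        · rw [inner_sub_left, hw, inner_add_left, EuclideanSpace.inner_single_left,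
            EuclideanSpace.inner_single_left, hw', EuclideanSpace.inner_single_left, hua, hub]
          simp
      rw [hRv]
      refine ⟨by rw [PiLp.add_apply, hw'a, hua, add_zero], by rw [PiLp.add_apply, hw'b, hub, add_zero]; exact hm0,
        fun c hca hcb => ?_⟩
      rw [PiLp.add_apply, hw'c c hca hcb, zero_add, hu, PiLp.sub_apply, hwc c hca hcb, sub_zero]

/-! ### Generation of `SO(4)` -/

section Generation

variable (P : (E4 ≃ₗᵢ[ℝ] E4) → Prop)

/-- **Transport of (H2) by a conjugator**: if `P` is closed under `trans` and `symm`, contains every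
determinant-one isometry fixing `e₂, e₃`, and contains a determinant-one `Q` with `Q e₂ = ±e_a`,
`Q e₃ = ±e_b`, then `P` contains every determinant-one isometry fixing `e_a, e_b`. [folklore] -/
theorem stab_of_conj (hmul : ∀ A B, P A → P B → P (A.trans B)) (hinv : ∀ A, P A → P A.symm)
    (hplanar : ∀ A : E4 ≃ₗᵢ[ℝ] E4, 𝐝 A = 1 → A (𝐞 2) = 𝐞 2 → A (𝐞 3) = 𝐞 3 → P A)
    {Q : E4 ≃ₗᵢ[ℝ] E4} (hQ : P Q) (hQdet : 𝐝 Q = 1) {a b : Fin 4}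
    (hQa : Q (𝐞 2) = 𝐞 a ∨ Q (𝐞 2) = -𝐞 a) (hQb : Q (𝐞 3) = 𝐞 b ∨ Q (𝐞 3) = -𝐞 b)
    (R : E4 ≃ₗᵢ[ℝ] E4) (hR : 𝐝 R = 1) (hRa : R (𝐞 a) = 𝐞 a) (hRb : R (𝐞 b) = 𝐞 b) : P R := by
  -- `C = Q⁻¹ R Q` fixes `e₂, e₃`
  set C : E4 ≃ₗᵢ[ℝ] E4 := Q.trans (R.trans Q.symm) with hC
  have hCdet : 𝐝 C = 1 := by rw [hC, det_trans, det_trans, hQdet, hR, det_symm hQdet]; norm_num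
  have hC2 : C (𝐞 2) = 𝐞 2 := by
    rw [hC, LinearIsometryEquiv.trans_apply, LinearIsometryEquiv.trans_apply]
    rcases hQa with h | h
    · rw [h, hRa, ← h, LinearIsometryEquiv.symm_apply_apply]
    · rw [h, map_neg, hRa, ← h, LinearIsometryEquiv.symm_apply_apply]
  have hC3 : C (𝐞 3) = 𝐞 3 := by
    rw [hC, LinearIsometryEquiv.trans_apply, LinearIsometryEquiv.trans_apply]
    rcases hQb with h | h
    · rw [h, hRb, ← h, LinearIsometryEquiv.symm_apply_apply]
    · rw [h, map_neg, hRb, ← h, LinearIsometryEquiv.symm_apply_apply]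
  have hPC : P C := hplanar C hCdet hC2 hC3
  have hRC : R = Q.symm.trans (C.trans Q) := by
    ext x
    simp [hC]
  rw [hRC]
  exact hmul _ _ (hinv _ hQ) (hmul _ _ hPC hQ)

/-- **`SO(4)` from proper signed permutations and one coordinate `SO(2)`**: a predicate on the linear
isometries of `ℝ⁴` that is closed under composition and inverses, holds on every determinant-one
isometry permuting the axes up to sign, and holds on every determinant-one isometry fixing `e₂, e₃`,
holds on every determinant-one isometry (Givens generation of `SO(4)`). [folklore] -/
theorem so4_generation (hmul : ∀ A B, P A → P B → P (A.trans B)) (hinv : ∀ A, P A → P A.symm)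
    (hhyper : ∀ A : E4 ≃ₗᵢ[ℝ] E4, 𝐝 A = 1 →
      (∀ i : Fin 4, ∃ j : Fin 4, A (𝐞 i) = 𝐞 j ∨ A (𝐞 i) = -𝐞 j) → P A)
    (hplanar : ∀ A : E4 ≃ₗᵢ[ℝ] E4, 𝐝 A = 1 → A (𝐞 2) = 𝐞 2 → A (𝐞 3) = 𝐞 3 → P A)
    (R : E4 ≃ₗᵢ[ℝ] E4) (hR : 𝐝 R = 1) : P R := by
  -- the two transported stabilisers
  obtain ⟨hAdet, hA0, hA1, hA2, hA3⟩ := QA_spec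
  obtain ⟨hBdet, hB0, hB1, hB2, hB3⟩ := QB_spec
  have hPA : P ((𝐫 (𝐞 0)).trans (𝐫 (𝐞 0 - 𝐞 2))) := by
    refine hhyper _ hAdet fun i => ?_
    fin_cases i
    · exact ⟨2, Or.inr hA0⟩
    · exact ⟨1, Or.inl hA1⟩
    · exact ⟨0, Or.inl hA2⟩
    · exact ⟨3, Or.inl hA3⟩
  have hPB : P ((𝐫 (𝐞 0 - 𝐞 2)).trans (𝐫 (𝐞 1 - 𝐞 3))) := by
    refine hhyper _ hBdet fun i => ?_
    fin_cases i
    · exact ⟨2, Or.inl hB0⟩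
    · exact ⟨3, Or.inl hB1⟩
    · exact ⟨0, Or.inl hB2⟩
    · exact ⟨1, Or.inl hB3⟩
  -- stabiliser of `(e₀, e₃)` and of `(e₀, e₁)`
  have stab03 : ∀ A : E4 ≃ₗᵢ[ℝ] E4, 𝐝 A = 1 → A (𝐞 0) = 𝐞 0 → A (𝐞 3) = 𝐞 3 → P A :=
    stab_of_conj P hmul hinv hplanar hPA hAdet (Or.inl hA2) (Or.inl hA3)
  have stab01 : ∀ A : E4 ≃ₗᵢ[ℝ] E4, 𝐝 A = 1 → A (𝐞 0) = 𝐞 0 → A (𝐞 1) = 𝐞 1 → P A :=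
    stab_of_conj P hmul hinv hplanar hPB hBdet (Or.inl hB2) (Or.inl hB3)
  have h01 : (0 : Fin 4) ≠ 1 := by decide
  have h12 : (1 : Fin 4) ≠ 2 := by decide
  have h23 : (2 : Fin 4) ≠ 3 := by decide
  -- Step A: move `R e₃` to `e₃`
  set v : E4 := R (𝐞 3) with hv
  have hvn : ‖v‖ = 1 := by rw [hv, LinearIsometryEquiv.norm_map, norm_e]
  obtain ⟨G1, hG1det, hG1fix, hG1a, -, hG1c⟩ := givens 0 1 h01 v
  obtain ⟨G2, hG2det, hG2fix, hG2a, -, hG2c⟩ := givens 1 2 h12 (G1 v)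
  obtain ⟨G3, hG3det, hG3fix, hG3a, hG3b, hG3c⟩ := givens 2 3 h23 (G2 (G1 v))
  have hPG1 : P G1 := hplanar G1 hG1det (hG1fix 2 (by decide) (by decide)) (hG1fix 3 (by decide) (by decide))
  have hPG2 : P G2 := stab03 G2 hG2det (hG2fix 0 (by decide) (by decide)) (hG2fix 3 (by decide) (by decide))
  have hPG3 : P G3 := stab01 G3 hG3det (hG3fix 0 (by decide) (by decide)) (hG3fix 1 (by decide) (by decide))
  have hT3 : G3 (G2 (G1 v)) = 𝐞 3 := by
    refine eq_e_of_norm_one (by rw [LinearIsometryEquiv.norm_map, LinearIsometryEquiv.norm_map,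
      LinearIsometryEquiv.norm_map, hvn]) 3 (fun c hc => ?_) hG3b
    rcases four_cases c with rfl | rfl | rfl | rfl
    · rw [hG3c 0 (by decide) (by decide), hG2c 0 (by decide) (by decide), hG1a]
    · rw [hG3c 1 (by decide) (by decide), hG2a]
    · exact hG3a
    · exact absurd rfl hc
  set T : E4 ≃ₗᵢ[ℝ] E4 := G1.trans (G2.trans G3) with hT
  have hPT : P T := hmul _ _ hPG1 (hmul _ _ hPG2 hPG3)
  have hTdet : 𝐝 T = 1 := by rw [hT, det_trans, det_trans, hG1det, hG2det, hG3det]; norm_num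
  have hTv : T v = 𝐞 3 := by rw [hT, LinearIsometryEquiv.trans_apply, LinearIsometryEquiv.trans_apply, hT3]
  -- `R' = T ∘ R` fixes `e₃`
  set R' : E4 ≃ₗᵢ[ℝ] E4 := R.trans T with hR'
  have hR'det : 𝐝 R' = 1 := by rw [hR', det_trans, hR, hTdet, one_mul]
  have hR'3 : R' (𝐞 3) = 𝐞 3 := by rw [hR', LinearIsometryEquiv.trans_apply, ← hv, hTv]
  -- Step B: move `R' e₂` to `e₂` inside the stabiliser of `e₃`
  set u : E4 := R' (𝐞 2) with hu
  have hun : ‖u‖ = 1 := by rw [hu, LinearIsometryEquiv.norm_map, norm_e]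
  have hu3 : u 3 = 0 := by
    rw [← inner_e_left, ← hR'3, hu, LinearIsometryEquiv.inner_map_map, inner_e_e, if_neg h23.symm]
  obtain ⟨G4, hG4det, hG4fix, hG4a, -, hG4c⟩ := givens 0 1 h01 u
  obtain ⟨G5, hG5det, hG5fix, hG5a, hG5b, hG5c⟩ := givens 1 2 h12 (G4 u)
  have hPG4 : P G4 := hplanar G4 hG4det (hG4fix 2 (by decide) (by decide)) (hG4fix 3 (by decide) (by decide))
  have hPG5 : P G5 := stab03 G5 hG5det (hG5fix 0 (by decide) (by decide)) (hG5fix 3 (by decide) (by decide))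
  have hT2 : G5 (G4 u) = 𝐞 2 := by
    refine eq_e_of_norm_one (by rw [LinearIsometryEquiv.norm_map, LinearIsometryEquiv.norm_map, hun]) 2
      (fun c hc => ?_) hG5b
    rcases four_cases c with rfl | rfl | rfl | rfl
    · rw [hG5c 0 (by decide) (by decide), hG4a]
    · exact hG5a
    · exact absurd rfl hc
    · rw [hG5c 3 (by decide) (by decide), hG4c 3 (by decide) (by decide), hu3]
  set T' : E4 ≃ₗᵢ[ℝ] E4 := G4.trans G5 with hT'
  have hPT' : P T' := hmul _ _ hPG4 hPG5
  have hT'det : 𝐝 T' = 1 := by rw [hT', det_trans, hG4det, hG5det, one_mul]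
  have hT'3 : T' (𝐞 3) = 𝐞 3 := by
    rw [hT', LinearIsometryEquiv.trans_apply, hG4fix 3 (by decide) (by decide), hG5fix 3 (by decide) (by decide)]
  have hT'u : T' u = 𝐞 2 := by rw [hT', LinearIsometryEquiv.trans_apply, hT2]
  -- `R'' = T' ∘ R'` fixes `e₂` and `e₃`, hence lies in (H2)
  set R'' : E4 ≃ₗᵢ[ℝ] E4 := R'.trans T' with hR''
  have hR''det : 𝐝 R'' = 1 := by rw [hR'', det_trans, hR'det, hT'det, one_mul]
  have hR''2 : R'' (𝐞 2) = 𝐞 2 := by rw [hR'', LinearIsometryEquiv.trans_apply, ← hu, hT'u]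
  have hR''3 : R'' (𝐞 3) = 𝐞 3 := by rw [hR'', LinearIsometryEquiv.trans_apply, hR'3, hT'3]
  have hPR'' : P R'' := hplanar R'' hR''det hR''2 hR''3
  -- unwind: `R = T⁻¹ T'⁻¹ R''`
  have hReq : R = R''.trans (T'.symm.trans T.symm) := by
    ext x
    simp [hR'', hR']
  rw [hReq]
  exact hmul _ _ hPR'' (hmul _ _ (hinv _ hPT') (hinv _ hPT))

end Generation

end PlanarToEuclidean

end Summit.QuantumFields.YangMills.Theorems

end
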